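import Literature.Analysis.UnboundedOperators.SemigroupDuhamel
import HarnessLib

/-!
# Rank-one perturbations of a generator: the Duhamel formula becomes a scalar RENEWAL EQUATION
  (Volterra equation of the second kind) for `m(t) = ℓ(S(t)x)`

Analysis/UnboundedOperators proofs-layer file (theorems only, no definitions, no named facts),
continuing `SemigroupDuhamel.lean`. If the generators of two C₀-semigroups `S`, `T` on a Banach
space have the same domain and differ there by a RANK-ONE bounded operator,

  `A_S u = A_T u + ℓ(u)·f`   (`ℓ ∈ E*`, `f ∈ E`),

then the variation of parameters formula (Engel–Nagel III Cor. 1.7, tree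
`app_eq_add_integral_of_generator`) reads

* `app_eq_add_integral_rankOne`:  `S(t)x = T(t)x + ∫₀ᵗ ℓ(S(s)x) · T(t − s)f ds`,

and applying `ℓ` (which commutes with the Bochner integral) gives the **scalar renewal equation**

* `renewal_equation`:  `m(t) = m₀(t) + ∫₀ᵗ k(t − s) m(s) ds`,
  `m(t) = ℓ(S(t)x)`, `m₀(t) = ℓ(T(t)x)`, `k(τ) = ℓ(T(τ)f)`,

with the a-priori bounds `|k(τ)| ≤ ‖ℓ‖‖T(τ)‖‖f‖`, `|m₀(t)| ≤ ‖ℓ‖‖T(t)‖‖x‖` (`norm_kernel_le`,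
`norm_forcing_le`, in the growth-bound form `‖T(τ)‖ ≤ Me^{ωτ}`) and the reconstruction bound
`‖S(t)x‖ ≤ ‖T(t)x‖ + ∫₀ᵗ |m(s)| ‖T(t − s)f‖ ds` (`norm_app_le_rankOne`): the perturbed orbit decays at a
given exponential rate iff the scalar `m` does. This is the classical reduction of rank-one feedback
to a Volterra/renewal equation (Feller XI; Prüss, *Evolutionary Integral Equations* (1993) §I.2;
Desch–Schappacher) and step (R-a) of the renewal route to linear stability for the sheet-ℝ
linearisation (`Summits/…/OSWSelfSimilar/SheetRLinearisedFlow.lean`, `T + θℓ(·)f`), whose kernel's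
Laplace transform is `1 − E(σ)` for the Evans function `E` of `SheetREvansOdd`.

## References

* K.-J. Engel, R. Nagel, *One-Parameter Semigroups for Linear Evolution Equations* (2000),
  Ch. III Cor. 1.7. [EngelNagel2000]
* J. Prüss, *Evolutionary Integral Equations and Applications* (1993), §I.2 (Volterra equations of
  scalar type); W. Feller, *An Introduction to Probability Theory II*, Ch. XI (renewal equation).
-/

noncomputable section

open MeasureTheory Set Filter Topology
open scoped NNReal

namespace Literature.Analysis.UnboundedOperators

namespace C0Semigroup

variable {𝕜 E : Type*} [RCLike 𝕜] [NormedAddCommGroup E] [NormedSpace 𝕜 E]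
variable [NormedSpace ℝ E] [IsScalarTower ℝ 𝕜 E] [CompleteSpace E]

omit [NormedSpace ℝ E] [IsScalarTower ℝ 𝕜 E] in
/-- The rank-one Duhamel integrand `s ↦ ℓ(S(s)x) · T(t − s)f` is continuous. [cite: EngelNagel2000, Ch. III Cor. 1.7] -/
theorem continuous_rankOne_integrand (S T : C0Semigroup 𝕜 E) (ℓ : E →L[𝕜] 𝕜) (f x : E) (t : ℝ) :
    Continuous fun s : ℝ => ℓ (S.app s.toNNReal x) • T.app (t - s).toNNReal f :=
  (ℓ.continuous.comp (S.continuous_app_toNNReal x)).smul (T.continuous_app_sub_apply t continuous_const)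

/-- **Rank-one variation of parameters**: if `A_S u = A_T u + ℓ(u)f` on the common domain, then
`S(t)x = T(t)x + ∫₀ᵗ ℓ(S(s)x) · T(t − s)f ds` for every `x` and `t ≥ 0`. [cite: EngelNagel2000, Ch. III Cor. 1.7] -/
theorem app_eq_add_integral_rankOne (S T : C0Semigroup 𝕜 E) (ℓ : E →L[𝕜] 𝕜) (f : E)
    (hdom : ∀ u : E, u ∈ S.generator.domain ↔ u ∈ T.generator.domain)
    (hgen : ∀ (u : E) (hS : u ∈ S.generator.domain) (hT : u ∈ T.generator.domain),
      S.generator ⟨u, hS⟩ = T.generator ⟨u, hT⟩ + ℓ u • f)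
    (x : E) {t : ℝ} (ht : 0 ≤ t) :
    S.app t.toNNReal x = T.app t.toNNReal x + ∫ s in (0 : ℝ)..t, ℓ (S.app s.toNNReal x) • T.app (t - s).toNNReal f := by
  have hgen' : ∀ (u : E) (hS : u ∈ S.generator.domain) (hT : u ∈ T.generator.domain),
      S.generator ⟨u, hS⟩ = T.generator ⟨u, hT⟩ + (ℓ.smulRight f) u := by
    intro u hS hT; rw [ContinuousLinearMap.smulRight_apply]; exact hgen u hS hT
  have h := app_eq_add_integral_of_generator S T (ℓ.smulRight f) hdom hgen' x ht
  rw [h]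
  congr 1
  refine intervalIntegral.integral_congr fun s _ => ?_
  simp only [ContinuousLinearMap.smulRight_apply, ContinuousLinearMap.map_smul_of_tower]

/-- **The scalar renewal equation.** With `m(t) = ℓ(S(t)x)`, `m₀(t) = ℓ(T(t)x)`, `k(τ) = ℓ(T(τ)f)`:
`m(t) = m₀(t) + ∫₀ᵗ k(t − s) m(s) ds` (`t ≥ 0`) — `ℓ` applied to the rank-one Duhamel formula,
commuting with the Bochner integral. [cite: EngelNagel2000, Ch. III Cor. 1.7] -/
theorem renewal_equation (S T : C0Semigroup 𝕜 E) (ℓ : E →L[𝕜] 𝕜) (f : E)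
    (hdom : ∀ u : E, u ∈ S.generator.domain ↔ u ∈ T.generator.domain)
    (hgen : ∀ (u : E) (hS : u ∈ S.generator.domain) (hT : u ∈ T.generator.domain),
      S.generator ⟨u, hS⟩ = T.generator ⟨u, hT⟩ + ℓ u • f)
    (x : E) {t : ℝ} (ht : 0 ≤ t) :
    ℓ (S.app t.toNNReal x) = ℓ (T.app t.toNNReal x)
      + ∫ s in (0 : ℝ)..t, ℓ (T.app (t - s).toNNReal f) * ℓ (S.app s.toNNReal x) := by
  have h := congrArg ℓ (app_eq_add_integral_rankOne S T ℓ f hdom hgen x ht)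
  rw [map_add, ← ℓ.intervalIntegral_comp_comm ((continuous_rankOne_integrand S T ℓ f x t).intervalIntegrable _ _)] at h
  rw [h]
  congr 1
  refine intervalIntegral.integral_congr fun s _ => ?_
  simp only [map_smul, smul_eq_mul, mul_comm]

omit [NormedSpace ℝ E] [IsScalarTower ℝ 𝕜 E] [CompleteSpace E] in
/-- **Kernel bound**: `|k(τ)| = |ℓ(T(τ)f)| ≤ ‖ℓ‖·M e^{ωτ}·‖f‖` under the growth bound `‖T(τ)‖ ≤ Me^{ωτ}`
(for the Hille–Yosida semigroup of a coercive operator: `M = 1`, `ω = −m`). [cite: EngelNagel2000, Ch. III Cor. 1.7] -/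
theorem norm_kernel_le (T : C0Semigroup 𝕜 E) {M ω : ℝ} (hM : ∀ t : ℝ≥0, ‖T.app t‖ ≤ M * Real.exp (ω * t))
    (ℓ : E →L[𝕜] 𝕜) (f : E) (τ : ℝ≥0) : ‖ℓ (T.app τ f)‖ ≤ ‖ℓ‖ * (M * Real.exp (ω * τ)) * ‖f‖ := by
  have hM0 : 0 ≤ M * Real.exp (ω * τ) := (norm_nonneg _).trans (hM τ)
  calc ‖ℓ (T.app τ f)‖ ≤ ‖ℓ‖ * ‖T.app τ f‖ := ℓ.le_opNorm _
    _ ≤ ‖ℓ‖ * (‖T.app τ‖ * ‖f‖) := mul_le_mul_of_nonneg_left (ContinuousLinearMap.le_opNorm _ _) (norm_nonneg _)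
    _ ≤ ‖ℓ‖ * (M * Real.exp (ω * τ) * ‖f‖) := by gcongr; exact hM τ
    _ = ‖ℓ‖ * (M * Real.exp (ω * τ)) * ‖f‖ := by ring

/-- **Reconstruction bound**: `‖S(t)x‖ ≤ ‖T(t)x‖ + ∫₀ᵗ |m(s)| ‖T(t − s)f‖ ds` — the perturbed orbit is
controlled by the free orbit and the scalar `m`. [cite: EngelNagel2000, Ch. III Cor. 1.7] -/
theorem norm_app_le_rankOne (S T : C0Semigroup 𝕜 E) (ℓ : E →L[𝕜] 𝕜) (f : E)
    (hdom : ∀ u : E, u ∈ S.generator.domain ↔ u ∈ T.generator.domain)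
    (hgen : ∀ (u : E) (hS : u ∈ S.generator.domain) (hT : u ∈ T.generator.domain),
      S.generator ⟨u, hS⟩ = T.generator ⟨u, hT⟩ + ℓ u • f)
    (x : E) {t : ℝ} (ht : 0 ≤ t) :
    ‖S.app t.toNNReal x‖ ≤ ‖T.app t.toNNReal x‖
      + ∫ s in (0 : ℝ)..t, ‖ℓ (S.app s.toNNReal x)‖ * ‖T.app (t - s).toNNReal f‖ := by
  rw [app_eq_add_integral_rankOne S T ℓ f hdom hgen x ht]
  refine (norm_add_le _ _).trans (add_le_add le_rfl ?_)
  refine (intervalIntegral.norm_integral_le_integral_norm ht).trans (le_of_eq ?_)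
  refine intervalIntegral.integral_congr fun s _ => ?_
  simp only [norm_smul]

end C0Semigroup

end Literature.Analysis.UnboundedOperators
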